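import Summits.BirchSwinnertonDyer.Rank1Residual.PrintCfram.SplitPlaceTorsionThree
import Summits.BirchSwinnertonDyer.Rank1Residual.X12.O11.RamifiedEllipticUnitMechanismZpThreeV
import HarnessLib

/-!
# Route `PrintCFram`: regime V `SplitPlaceTorsionBSDThree` (item stmt-BirchSwinnertonDyer-20700), regime
# N `TorsionFreeFrameBSDThree` (stmt-…-20698) and the crux C1 `CMRamifiedThreeBSD` ⟸ T, each BY NAME
# from the TWO class-wide `ℤ₃`-level laws on regimes N ∪ V — (IMC)₃ᴺ∪ⱽ and (PR|IMC)₃ᴺ∪ⱽ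
# (cell `bsd-print-cfram`, D-0131 (2) print tier, seat ty2 gen 3 = the cell's discharge-interface typer;
# PLAN v4.1 §1e ask (γ‴) «Zp₃-level seam for V … so that "zpthree" v3 has V DERIVED»)

HONEST FRAMING (cell `bsd-print-cfram`, HOME `run/shared/lean/pub/bsd-print-cfram/`): THEOREMS ONLY
(no definition, no named fact, no axiom, no `sorry`); nothing about BSD is booked; regimes N, V, the
crux C1 and the leaf `Summit.BirchSwinnertonDyer.WAllCornerFRamifiedAtThree` stay OPEN; 0 cells move;
beyond-print theorem: NO. `Theorems/` is prover-only for a literature-prover seat, so this file sits in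
the cell's `Rank1Residual/PrintCfram/` folder (like `SplitPlaceTorsionThree`, p554137).

CONTENT. The two `ℤ₃`-level carriers of `X12/O11/RamifiedEllipticUnitMechanismZpThreeV.lean` (ty2 gen 3)
— `X12.O11.RamifiedCMEllipticUnitIMCAtZpThreeV W` ((IMC)₃ᴺ∪ⱽ: the anticyclotomic elliptic-unit
main-conjecture identity at `3` with NO away binder) and `X12.O11.RamifiedCMBottomClassIndexLawAtZpThreeV W`
((PR|IMC)₃ᴺ∪ⱽ: Perrin-Riou's relative law with the bottom index `s = log₃ d(T₀)` displayed) — demanded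
CLASS-WIDE (at every globally minimal CM curve of analytic rank one with `3` ramified in the CM field;
the law under GZK, exactly as the route items `EllipticUnitIMCThree` / `BottomClassIndexLawThree` are
SHAPED — their current bodies name the regime-N carriers; the hypotheses below are written in UNFOLDED
form so that this file depends on no item body) give, BY NAME:
* §1 `indexLawAtThreeV_of_imcThreeV_of_indexLawThreeV` — the class-wide (R-EU)₃ᵛ law (GZK displayed),
  by the seam `X12.O11.ramifiedCMEllipticUnitIndexAtThreeV_of_imcZpThreeV_of_indexLawZpThreeV`;
* §2 `splitPlaceTorsionBSDThree_of_imcThreeV_of_indexLawThreeV` : **V** `Theses.PrintCFram.SplitPlaceTorsionBSDThree`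
  and `torsionFreeFrameBSDThree_of_imcThreeV_of_indexLawThreeV` : **N** `Theses.PrintCFram.TorsionFreeFrameBSDThree`
  (p554137's edges from the (R-EU)₃ᵛ law; GZK taken from each item's own antecedent), both at once, and
  `cmRamifiedThreeBSD_of_imcThreeV_of_indexLawThreeV_of_localThreeTorsion` : **C1** ⟸ the two laws ∧ T
  (`LocalThreeTorsionBSDThree`) via the landed glue — the «zpthree» v3 skeleton edge with V DERIVED;
* §3 the regime-N item SHAPES back: `forall_imcAtZpThree_of_forall_imcAtZpThreeV` and
  `forall_indexLawAtZpThree_of_forall_indexLawAtZpThreeV` — the current (regime-N) bodies of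
  `EllipticUnitIMCThree` / `BottomClassIndexLawThree` follow from the N ∪ V laws (ty2 gen 3's `T₀ = ∅`
  specialisations), so a planner `--restate` of the two items to the N ∪ V carriers loses no edge.
Nothing is asserted about either carrier (CONSTRUCTION / OPEN; not in print at `3`).

References: route file `Theses/PrintCFram.lean` rev ≥ 14 (items 20698, 20699, 20700, 20371, 21352, 21353);
`X12/O11/RamifiedEllipticUnitMechanismZpThree{,V}.lean` (p548597; ty2 gen 3); `PrintCfram/SplitPlaceTorsionThree.lean`
(p554137), `PrintCfram/RegimeSplitThree.lean` (p547523); HOME/PLAN.md v4.1 §1b, §1e; HOME/DOSSIER.md §35;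
[cite: Miller2011LMS, §1 and Def. 1.1 (arXiv:1010.2431 p. 3) (`BSDp`)]; [cite: GreenbergLNM1716, §3 Lemma
3.3 and §4 Prop. 4.13 (control and its defect)]; [cite: Kolyvagin1990, Thm. A]; [cite: GrossZagier1986,
Thm. I.(7.3)]; [cite: Cassels1965ArithmeticVIII].
-/

set_option autoImplicit false

noncomputable section

open scoped Classical

open WeierstrassCurve NumberField IsDedekindDomain Field
  Literature.NumberTheory.EllipticCurves
  Literature.NumberTheory.EllipticCurves.Rank1Residual
  Literature.NumberTheory.GaloisRepresentations
  Summit.BirchSwinnertonDyer.Rank1Residual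
  Summit.BirchSwinnertonDyer.Rank1Residual.X12.O11
  Summit.BirchSwinnertonDyer.BirchSwinnertonDyer.Theorems
  Summit.BirchSwinnertonDyer.BirchSwinnertonDyer.Theses.PrintCFram

namespace Summit.BirchSwinnertonDyer.Rank1Residual.PrintCfram

/-! ## §0 Frame-level consumers on regimes N ∪ V: the two carriers + four named facts ⟹ `BSD(W, 3)` -/

section ConsumerNV

variable {W : WeierstrassCurve ℚ} [W.IsElliptic] [W.IsGloballyMinimal]
variable {K : Type} [Field K] [NumberField K] {𝔭 : HeightOneSpectrum (𝓞 K)}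
  {W' : WeierstrassCurve ℚ} [W'.IsElliptic] [W'.IsGloballyMinimal] {C : VariableChange ℚ}
  {κ : ZpExtension K 3} {P : W.toAffine.Point} {n : ℕ} {P' : W'.toAffine.Point} {n' : ℕ}

/-- **`BSD(W, 3)` at an analytic-rank-one `3`-frame on regimes N ∪ V from (IMC)₃ᴺ∪ⱽ ∧ (PR|IMC)₃ᴺ∪ⱽ +
four named facts** — p553720's `bsdp_three_of_ramifiedCMEllipticUnitIndexAtThreeV` fed with ty2 gen
3's seam `X12.O11.ramifiedCMEllipticUnitIndexAtThreeV_of_imcZpThreeV_of_indexLawZpThreeV`; every binder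
displayed (frame, `r_an(W) = 1`, anticyclotomic `κ` with generator `γ`, generators with
`3`-divisibility levels, (A𝔭)₃, a finite `T₀` of places `v ∤ 3` with (Av)₃ off `T₀`, modularity
`hmod`, Gross–Zagier I.(7.3) `hGZ`, GZK `hGZK`, Cassels `hCassels`); the displayed index `log₃ d(T₀)`
cancels against the defect of the PROVED control theorem (R-ctrl)₃ᵛ♯. CONDITIONAL on the two typed
inputs; nothing booked. [cite: Miller2011LMS, §1 and Def. 1.1 (arXiv:1010.2431 p. 3)]
[cite: Cassels1965ArithmeticVIII] [cite: GrossZagier1986, Thm. I.(7.3)] -/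
theorem bsdp_three_of_imcZpThreeV_of_indexLawZpThreeV (hmod : hasEntireLFunction_rat)
    (hGZ : GrossZagier1986_thm_I_7_3) (hGZK : rank_eq_analyticRank_of_analyticRank_le_one)
    (hCassels : bsdRHS_eq_of_isIsogenous) (h1 : RamifiedCMEllipticUnitIMCAtZpThreeV W)
    (h2 : RamifiedCMBottomClassIndexLawAtZpThreeV W)
    (hF : IsFrameThree W K 𝔭 W' C) (hr : W.analyticRank = 1)
    (hκ : κ.IsAnticyclotomic) (γ : absoluteGaloisGroup K) [Fact (κ.IsTopGenerator γ)]
    (hP : ¬ IsOfFinAddOrder P)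
    (hgen : ∀ R : W.toAffine.Point, ∃ (k : ℤ) (T : W.toAffine.Point),
      IsOfFinAddOrder T ∧ R = k • P + T)
    (htors : ∀ Q : (W.baseChange ℚ_[3]).toAffine.Point, (3 : ℕ) • Q = 0 → Q = 0)
    (hdiv : ∃ Q : (W.baseChange ℚ_[3]).toAffine.Point, (3 : ℕ) ^ n • Q = W.toPadicPoint 3 P)
    (hndiv : ∀ Q : (W.baseChange ℚ_[3]).toAffine.Point, (3 : ℕ) ^ (n + 1) • Q ≠ W.toPadicPoint 3 P)
    (hP' : ¬ IsOfFinAddOrder P')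
    (hgen' : ∀ R : W'.toAffine.Point, ∃ (k : ℤ) (T : W'.toAffine.Point),
      IsOfFinAddOrder T ∧ R = k • P' + T)
    (htors' : ∀ Q : (W'.baseChange ℚ_[3]).toAffine.Point, (3 : ℕ) • Q = 0 → Q = 0)
    (hdiv' : ∃ Q : (W'.baseChange ℚ_[3]).toAffine.Point, (3 : ℕ) ^ n' • Q = W'.toPadicPoint 3 P')
    (hndiv' : ∀ Q : (W'.baseChange ℚ_[3]).toAffine.Point,
      (3 : ℕ) ^ (n' + 1) • Q ≠ W'.toPadicPoint 3 P')
    (T₀ : Finset (HeightOneSpectrum (𝓞 K))) (hT₀ : ∀ v ∈ T₀, ((3 : ℕ) : 𝓞 K) ∉ v.asIdeal)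
    (hv : ∀ v : HeightOneSpectrum (𝓞 K), v ∉ T₀ → ((3 : ℕ) : 𝓞 K) ∉ v.asIdeal →
      v.asIdeal.ramificationIdx (𝓞 ℚ) = 1 → v.asIdeal.inertiaDeg (𝓞 ℚ) = 1 →
      (W.baseChange K).HasGoodReductionAt v ∨
        ∀ R : ((W.baseChange K).baseChange (v.adicCompletion K)).toAffine.Point,
          (3 : ℕ) • R = 0 → R = 0) :
    BSDp W 3 :=
  bsdp_three_of_ramifiedCMEllipticUnitIndexAtThreeV hmod hGZ hGZK hCassels
    (ramifiedCMEllipticUnitIndexAtThreeV_of_imcZpThreeV_of_indexLawZpThreeV h1 h2) hF hr hκ γ hP hgen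
    htors hdiv hndiv hP' hgen' htors' hdiv' hndiv' T₀ hT₀ hv

/-- **`BSD(W, 3)` at ANY analytic-rank-one `3`-frame with (A𝔭)₃ — regimes N ∪ V together, NO away
binder, NO frame data — from (IMC)₃ᴺ∪ⱽ ∧ (PR|IMC)₃ᴺ∪ⱽ + four named facts**: p553720's
`bsdp_three_of_indexLawAtThreeV_of_isFrameThree` (`T₀ = Σ(N⁺)` admissible at every frame; tower,
generator and Mordell–Weil data built for the GIVEN frame) fed with the seam. This is the shape in
which the route items N (`TorsionFreeFrameBSDThree`) and V (`SplitPlaceTorsionBSDThree`) consume the two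
carriers (§2 below). CONDITIONAL; nothing booked.
[cite: Miller2011LMS, §1 and Def. 1.1 (arXiv:1010.2431 p. 3)] [cite: GrossZagier1986, Thm. I.(7.3)] -/
theorem bsdp_three_of_imcZpThreeV_of_indexLawZpThreeV_of_isFrameThree
    (hmod : hasEntireLFunction_rat) (hGZ : GrossZagier1986_thm_I_7_3)
    (hGZK : rank_eq_analyticRank_of_analyticRank_le_one) (hCassels : bsdRHS_eq_of_isIsogenous)
    (hF : IsFrameThree W K 𝔭 W' C) (hr : W.analyticRank = 1)
    (htors : ∀ Q : (W.baseChange ℚ_[3]).toAffine.Point, (3 : ℕ) • Q = 0 → Q = 0)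
    (htors' : ∀ Q : (W'.baseChange ℚ_[3]).toAffine.Point, (3 : ℕ) • Q = 0 → Q = 0)
    (h1 : RamifiedCMEllipticUnitIMCAtZpThreeV W) (h2 : RamifiedCMBottomClassIndexLawAtZpThreeV W) :
    BSDp W 3 :=
  bsdp_three_of_indexLawAtThreeV_of_isFrameThree hmod hGZ hGZK hCassels hF hr htors htors'
    (ramifiedCMEllipticUnitIndexAtThreeV_of_imcZpThreeV_of_indexLawZpThreeV h1 h2)

end ConsumerNV

/-! ## §1 The class-wide (R-EU)₃ᵛ law from the two class-wide `ℤ₃`-level laws -/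

/-- **Class-wide (IMC)₃ᴺ∪ⱽ ∧ class-wide (PR|IMC)₃ᴺ∪ⱽ (under GZK) ⟹ class-wide (R-EU)₃ᵛ, GZK displayed.**
Pointwise the seam `X12.O11.ramifiedCMEllipticUnitIndexAtThreeV_of_imcZpThreeV_of_indexLawZpThreeV`;
the hypotheses are SHAPED like the route items `EllipticUnitIMCThree` (`∀ W, HasCM → CMRamified W 3 →
r_an = 1 → carrier`) and `BottomClassIndexLawThree` (`GZK → ∀ W, …`) with the N ∪ V carriers.
CONDITIONAL; nothing booked. [cite: Miller2011LMS, Def. 1.1] [cite: Kolyvagin1990, Thm. A] -/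
theorem indexLawAtThreeV_of_imcThreeV_of_indexLawThreeV
    (h1 : ∀ (W : WeierstrassCurve ℚ) [W.IsElliptic] [W.IsGloballyMinimal],
      W.HasCM → CMRamified W 3 → W.analyticRank = 1 → RamifiedCMEllipticUnitIMCAtZpThreeV W)
    (h2 : rank_eq_analyticRank_of_analyticRank_le_one →
      ∀ (W : WeierstrassCurve ℚ) [W.IsElliptic] [W.IsGloballyMinimal],
      W.HasCM → CMRamified W 3 → W.analyticRank = 1 → RamifiedCMBottomClassIndexLawAtZpThreeV W)
    (hGZK : rank_eq_analyticRank_of_analyticRank_le_one) :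
    ∀ (W : WeierstrassCurve ℚ) [W.IsElliptic] [W.IsGloballyMinimal],
      W.HasCM → W.analyticRank = 1 → CMRamified W 3 → RamifiedCMEllipticUnitIndexAtThreeV W :=
  fun W _ _ hCM hr hram =>
    ramifiedCMEllipticUnitIndexAtThreeV_of_imcZpThreeV_of_indexLawZpThreeV (h1 W hCM hram hr)
      (h2 hGZK W hCM hram hr)

/-! ## §2 Regimes V and N, and C1 ⟸ T, BY NAME from the two class-wide laws -/

/-- **Regime V ⟸ class-wide (IMC)₃ᴺ∪ⱽ ∧ class-wide (PR|IMC)₃ᴺ∪ⱽ (under GZK).** The route declaration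
`Theses.PrintCFram.SplitPlaceTorsionBSDThree` (item stmt-BirchSwinnertonDyer-20700) BY NAME: GZK is
the item's own third antecedent, then §1 and p554137's `splitPlaceTorsionBSDThree_of_indexLawAtThreeV`
(consumer at `T₀ = Σ(N⁺)`, exact control (R-ctrl)₃ᵛ♯ a theorem, (R-tors)₃ᵛ ⟸ GZK). This is the
«zpthree» v3 edge that makes V DERIVED from the two `ℤ₃`-level items once they name the N ∪ V carriers.
CONDITIONAL on `h1`, `h2`; the type of the conclusion is literally the route declaration; nothing booked.
[cite: Miller2011LMS, §1 and Def. 1.1 (arXiv:1010.2431 p. 3)] -/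
theorem splitPlaceTorsionBSDThree_of_imcThreeV_of_indexLawThreeV
    (h1 : ∀ (W : WeierstrassCurve ℚ) [W.IsElliptic] [W.IsGloballyMinimal],
      W.HasCM → CMRamified W 3 → W.analyticRank = 1 → RamifiedCMEllipticUnitIMCAtZpThreeV W)
    (h2 : rank_eq_analyticRank_of_analyticRank_le_one →
      ∀ (W : WeierstrassCurve ℚ) [W.IsElliptic] [W.IsGloballyMinimal],
      W.HasCM → CMRamified W 3 → W.analyticRank = 1 → RamifiedCMBottomClassIndexLawAtZpThreeV W) :
    Summit.BirchSwinnertonDyer.BirchSwinnertonDyer.Theses.PrintCFram.SplitPlaceTorsionBSDThree :=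
  fun hmod hGZ hGZK hCassels =>
    splitPlaceTorsionBSDThree_of_indexLawAtThreeV
      (indexLawAtThreeV_of_imcThreeV_of_indexLawThreeV h1 h2 hGZK) hmod hGZ hGZK hCassels

/-- **Regime N ⟸ the same two class-wide laws** (`Theses.PrintCFram.TorsionFreeFrameBSDThree`, item
stmt-BirchSwinnertonDyer-20698), through p554137's `torsionFreeFrameBSDThree_of_indexLawAtThreeV`:
the two N ∪ V carriers serve N and V alike. [cite: Miller2011LMS, §1 and Def. 1.1 (arXiv:1010.2431 p. 3)] -/
theorem torsionFreeFrameBSDThree_of_imcThreeV_of_indexLawThreeV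
    (h1 : ∀ (W : WeierstrassCurve ℚ) [W.IsElliptic] [W.IsGloballyMinimal],
      W.HasCM → CMRamified W 3 → W.analyticRank = 1 → RamifiedCMEllipticUnitIMCAtZpThreeV W)
    (h2 : rank_eq_analyticRank_of_analyticRank_le_one →
      ∀ (W : WeierstrassCurve ℚ) [W.IsElliptic] [W.IsGloballyMinimal],
      W.HasCM → CMRamified W 3 → W.analyticRank = 1 → RamifiedCMBottomClassIndexLawAtZpThreeV W) :
    Summit.BirchSwinnertonDyer.BirchSwinnertonDyer.Theses.PrintCFram.TorsionFreeFrameBSDThree :=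
  fun hmod hGZ hGZK hCassels =>
    torsionFreeFrameBSDThree_of_indexLawAtThreeV
      (indexLawAtThreeV_of_imcThreeV_of_indexLawThreeV h1 h2 hGZK) hmod hGZ hGZK hCassels

/-- **N ∧ V from the two class-wide laws, at once.** [cite: Miller2011LMS, §1 and Def. 1.1 (arXiv:1010.2431 p. 3)] -/
theorem torsionFree_and_splitPlace_of_imcThreeV_of_indexLawThreeV
    (h1 : ∀ (W : WeierstrassCurve ℚ) [W.IsElliptic] [W.IsGloballyMinimal],
      W.HasCM → CMRamified W 3 → W.analyticRank = 1 → RamifiedCMEllipticUnitIMCAtZpThreeV W)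
    (h2 : rank_eq_analyticRank_of_analyticRank_le_one →
      ∀ (W : WeierstrassCurve ℚ) [W.IsElliptic] [W.IsGloballyMinimal],
      W.HasCM → CMRamified W 3 → W.analyticRank = 1 → RamifiedCMBottomClassIndexLawAtZpThreeV W) :
    Summit.BirchSwinnertonDyer.BirchSwinnertonDyer.Theses.PrintCFram.TorsionFreeFrameBSDThree ∧
      Summit.BirchSwinnertonDyer.BirchSwinnertonDyer.Theses.PrintCFram.SplitPlaceTorsionBSDThree :=
  ⟨torsionFreeFrameBSDThree_of_imcThreeV_of_indexLawThreeV h1 h2,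
    splitPlaceTorsionBSDThree_of_imcThreeV_of_indexLawThreeV h1 h2⟩

/-- **C1 ⟸ class-wide (IMC)₃ᴺ∪ⱽ ∧ class-wide (PR|IMC)₃ᴺ∪ⱽ ∧ T**, BY NAME: with the glue of the tenure
split (`cmRamifiedThreeBSDOfRegimes_holds`, p547523) the `@3` crux `Theses.PrintCFram.CMRamifiedThreeBSD`
follows from the two `ℤ₃`-level laws on regimes N ∪ V and regime T (`LocalThreeTorsionBSDThree`, the
`ℚ₃`-rational-`3`-torsion members). This is the content line «zpthree» with V DERIVED:
C1 ⟸ (IMC)₃ᴺ∪ⱽ ∧ (PR|IMC)₃ᴺ∪ⱽ ∧ T. CONDITIONAL on the three hypotheses; nothing booked.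
[cite: Miller2011LMS, §1 and Def. 1.1 (arXiv:1010.2431 p. 3)] -/
theorem cmRamifiedThreeBSD_of_imcThreeV_of_indexLawThreeV_of_localThreeTorsion
    (h1 : ∀ (W : WeierstrassCurve ℚ) [W.IsElliptic] [W.IsGloballyMinimal],
      W.HasCM → CMRamified W 3 → W.analyticRank = 1 → RamifiedCMEllipticUnitIMCAtZpThreeV W)
    (h2 : rank_eq_analyticRank_of_analyticRank_le_one →
      ∀ (W : WeierstrassCurve ℚ) [W.IsElliptic] [W.IsGloballyMinimal],
      W.HasCM → CMRamified W 3 → W.analyticRank = 1 → RamifiedCMBottomClassIndexLawAtZpThreeV W)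
    (hT : Summit.BirchSwinnertonDyer.BirchSwinnertonDyer.Theses.PrintCFram.LocalThreeTorsionBSDThree) :
    Summit.BirchSwinnertonDyer.BirchSwinnertonDyer.Theses.PrintCFram.CMRamifiedThreeBSD :=
  cmRamifiedThreeBSDOfRegimes_holds (torsionFreeFrameBSDThree_of_imcThreeV_of_indexLawThreeV h1 h2) hT
    (splitPlaceTorsionBSDThree_of_imcThreeV_of_indexLawThreeV h1 h2)

/-! ## §3 The regime-N item shapes follow from the N ∪ V laws (so a `--restate` loses no edge) -/

/-- **Class-wide (IMC)₃ᴺ∪ⱽ ⟹ class-wide (IMC)₃ᴺ** — the CURRENT body shape of route item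
`EllipticUnitIMCThree` (regime-N carrier `X12.O11.RamifiedCMEllipticUnitIMCAtZpThree`) from the N ∪ V
law, by ty2 gen 3's specialisation `ramifiedCMEllipticUnitIMCAtZpThree_of_imcAtZpThreeV`.
[cite: BurungaleKobayashiNakamuraOta2026, Prop. 3.7 (2) and Thm. 3.14 (2) (arXiv:2608.06879 pp. 19–20, 22–24) (claim; preprint; shape only)] -/
theorem forall_imcAtZpThree_of_forall_imcAtZpThreeV
    (h1 : ∀ (W : WeierstrassCurve ℚ) [W.IsElliptic] [W.IsGloballyMinimal],
      W.HasCM → CMRamified W 3 → W.analyticRank = 1 → RamifiedCMEllipticUnitIMCAtZpThreeV W) :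
    ∀ (W : WeierstrassCurve ℚ) [W.IsElliptic] [W.IsGloballyMinimal],
      W.HasCM → CMRamified W 3 → W.analyticRank = 1 → RamifiedCMEllipticUnitIMCAtZpThree W :=
  fun W _ _ hCM hram hr => ramifiedCMEllipticUnitIMCAtZpThree_of_imcAtZpThreeV (h1 W hCM hram hr)

/-- **Class-wide (PR|IMC)₃ᴺ∪ⱽ under GZK ⟹ class-wide (PR|IMC)₃ᴺ under GZK** — the CURRENT body shape of
route item `BottomClassIndexLawThree` (regime-N carrier `X12.O11.RamifiedCMBottomClassIndexLawAtZpThree`)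
from the N ∪ V law, by ty2 gen 3's specialisation `ramifiedCMBottomClassIndexLawAtZpThree_of_indexLawAtZpThreeV`
(`log₃ d(∅) = 0` under (A𝔭)₃). [cite: GreenbergLNM1716, §3 pp. 74–75 and Lemma 3.3] [cite: PerrinRiou1993AIF, §3.3.4–3.3.5] -/
theorem forall_indexLawAtZpThree_of_forall_indexLawAtZpThreeV
    (h2 : rank_eq_analyticRank_of_analyticRank_le_one →
      ∀ (W : WeierstrassCurve ℚ) [W.IsElliptic] [W.IsGloballyMinimal],
      W.HasCM → CMRamified W 3 → W.analyticRank = 1 → RamifiedCMBottomClassIndexLawAtZpThreeV W) :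
    rank_eq_analyticRank_of_analyticRank_le_one →
      ∀ (W : WeierstrassCurve ℚ) [W.IsElliptic] [W.IsGloballyMinimal],
      W.HasCM → CMRamified W 3 → W.analyticRank = 1 → RamifiedCMBottomClassIndexLawAtZpThree W :=
  fun hGZK W _ _ hCM hram hr =>
    ramifiedCMBottomClassIndexLawAtZpThree_of_indexLawAtZpThreeV (h2 hGZK W hCM hram hr)

end Summit.BirchSwinnertonDyer.Rank1Residual.PrintCfram

end
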